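import Summits.CriticalPhenomena.PercolationContinuityZ3.Theorems.PercNearOneGluingNoHeavyLowerTailSahiSunflowerTower
import HarnessLib

/-!
# `NoHeavyLowerTail` (crux stmt-CriticalPhenomena-4575), master-family line P2 (Sahi's algebraic route):
# MERGE MAPS of the sunflower poset `Sun m` (petal ↦ petal, petal ↦ outside) — pull-backs of the up-sets `U S` and push-forward weights

Support file (seat `prim-masterthm-p2`, gen 4; `--supports stmt-CriticalPhenomena-4575`); no named fact, no sorry.  Companion of `…SahiSunflowerTower`
(`Sun m`, `U S`), `…SahiSunflowerTowerSymmetry` (petal permutations).  Memo SAHI-ROUTE.md §4.13.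

`merge j z : Sun m → Sun m` sends the petal `pet j` to the point `z` and fixes everything else; for `z = pet x` ("merge petal `j` into petal `x`")
and `z = out` ("merge petal `j` into the outside") these are the MONOTONE maps along which the all-`m` hierarchy theorem transfers a co-singleton
family once the outside petal `j` has been made parallel to the petal `x` (resp. to the outside):
* `setInd_U_comp_merge_out`, `setInd_U_comp_merge_pet_of_mem / _of_not_mem` — the pull-back of `U S` is `U (insert j S)` (resp. `U (S.erase j)`);
* `pushWeight_merge_*` — the push-forward weight: core mass unchanged, petal `j` becomes NULL, its mass goes to petal `x` (resp. to the outside);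
* `sahiE_merge` — `E^{merge_* ν}(χ_{U ∘ T}) = E^{ν}(χ_{U ∘ T} ∘ merge)` (an instance of `sahiE_pushWeight`).
-/

namespace Summit.CriticalPhenomena.PercolationContinuityZ3.Theorems.SahiDeltaSystem

open Finset Function Literature.Combinatorics.Sahi2008

namespace Sun

variable {m : ℕ}

/-- **Merge map**: `pet j ↦ z`, identity elsewhere. [this work] -/
def merge (j : Fin m) (z : Sun m) : Sun m → Sun m
  | core => core
  | pet i => if i = j then z else pet i
  | out => out

/-- `merge` on the constructors. [this work] -/
@[simp] theorem merge_core (j : Fin m) (z : Sun m) : merge j z core = core := rfl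
/-- `merge` on the constructors. [this work] -/
@[simp] theorem merge_out (j : Fin m) (z : Sun m) : merge j z out = out := rfl
/-- `merge` on the merged petal. [this work] -/
@[simp] theorem merge_pet_self (j : Fin m) (z : Sun m) : merge j z (pet j) = z := by simp [merge]
/-- `merge` on the other petals. [this work] -/
theorem merge_pet_of_ne {j i : Fin m} (z : Sun m) (h : i ≠ j) : merge j z (pet i) = pet i := by simp [merge, h]
/-- `merge` on a petal, by cases. [this work] -/
theorem merge_pet (j i : Fin m) (z : Sun m) : merge j z (pet i) = if i = j then z else pet i := rfl

/-- **`merge j z` is monotone** (the order of `Sun m` only says `core ≤ _` and `_ ≤ out`, and both extremes are fixed). [this work] -/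
theorem monotone_merge (j : Fin m) (z : Sun m) : Monotone (merge j z) := by
  intro x y hxy
  rw [le_iff] at hxy ⊢
  rcases hxy with rfl | rfl | rfl
  · exact Or.inl rfl
  · exact Or.inr (Or.inl rfl)
  · exact Or.inr (Or.inr rfl)

/-! ## Pull-backs of the up-sets `U S` -/

/-- **Pull-back along the outside merge**: `χ_{U S} ∘ merge j out = χ_{U (insert j S)}`. [this work] -/
theorem setInd_U_comp_merge_out (j : Fin m) (S : Finset (Fin m)) :
    setInd (U S) ∘ merge j out = setInd (U (insert j S)) := by
  funext y
  rcases y with _ | i | _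
  · simp [setInd_apply]
  · by_cases hij : i = j
    · subst hij; simp [setInd_apply]
    · simp [setInd_apply, merge_pet_of_ne _ hij, hij]
  · simp [setInd_apply]

/-- **Pull-back along a petal merge, target petal in the index set**: `x ∈ S ⇒ χ_{U S} ∘ merge j (pet x) = χ_{U (insert j S)}`. [this work] -/
theorem setInd_U_comp_merge_pet_of_mem (j : Fin m) {x : Fin m} {S : Finset (Fin m)} (hx : x ∈ S) :
    setInd (U S) ∘ merge j (pet x) = setInd (U (insert j S)) := by
  funext y
  rcases y with _ | i | _
  · simp [setInd_apply]
  · by_cases hij : i = j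
    · subst hij; simp [setInd_apply, hx]
    · simp [setInd_apply, merge_pet_of_ne _ hij, hij]
  · simp [setInd_apply]

/-- **Pull-back along a petal merge, target petal outside the index set**: `x ∉ S ⇒ χ_{U S} ∘ merge j (pet x) = χ_{U (S.erase j)}`. [this work] -/
theorem setInd_U_comp_merge_pet_of_not_mem (j : Fin m) {x : Fin m} {S : Finset (Fin m)} (hx : x ∉ S) :
    setInd (U S) ∘ merge j (pet x) = setInd (U (S.erase j)) := by
  funext y
  rcases y with _ | i | _
  · simp [setInd_apply]
  · by_cases hij : i = j
    · subst hij; simp [setInd_apply, hx]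
    · simp [setInd_apply, merge_pet_of_ne _ hij, hij]
  · simp [setInd_apply]

/-- **`E_n` transports along a merge**: `E^{merge_* ν}_n(χ_{V_i}) = E^{ν}_n(χ_{V_i} ∘ merge)`. [this work] -/
theorem sahiE_pushWeight_merge (ν : Sun m → ℝ) (j : Fin m) (z : Sun m) {n : ℕ} (V : Fin n → Finset (Sun m)) :
    sahiE (pushWeight ν (merge j z)) n (fun i => setInd (V i)) = sahiE ν n (fun i => setInd (V i) ∘ merge j z) :=
  sahiE_pushWeight ν (merge j z) n _

/-! ## The push-forward weights -/

/-- The merged weight is nonnegative. [this work] -/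
theorem pushWeight_merge_nonneg {ν : Sun m → ℝ} (hν0 : ∀ y, 0 ≤ ν y) (j : Fin m) (z : Sun m) (y : Sun m) :
    0 ≤ pushWeight ν (merge j z) y :=
  pushWeight_nonneg hν0 _ y

/-- The merged weight has the same total mass. [this work] -/
theorem sum_pushWeight_merge (ν : Sun m → ℝ) (j : Fin m) (z : Sun m) : ∑ y, pushWeight ν (merge j z) y = ∑ y, ν y :=
  sum_pushWeight ν _

/-- Unfolding the push-forward on `Sun m`: core, outside and petal contributions. [this work] -/
theorem pushWeight_merge_apply (ν : Sun m → ℝ) (j : Fin m) (z c : Sun m) :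
    pushWeight ν (merge j z) c = (if core = c then ν core else 0) + (if out = c then ν out else 0) +
      ∑ i : Fin m, if merge j z (pet i) = c then ν (pet i) else 0 := by
  rw [pushWeight_apply, sum_eq]
  simp only [merge_core, merge_out]
  congr 1

/-- The petal sum of `pushWeight_merge_apply`, evaluated. [this work] -/
theorem sum_merge_pet_ite (ν : Sun m → ℝ) (j : Fin m) (z c : Sun m) :
    (∑ i : Fin m, if merge j z (pet i) = c then ν (pet i) else 0) =
      (if z = c then ν (pet j) else 0) + ∑ i : Fin m, if i ≠ j ∧ pet i = c then ν (pet i) else 0 := by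
  have key : ∀ i : Fin m, (if merge j z (pet i) = c then ν (pet i) else 0) =
      (if i = j ∧ z = c then ν (pet i) else 0) + (if i ≠ j ∧ pet i = c then ν (pet i) else 0) := by
    intro i
    by_cases hij : i = j
    · subst hij; by_cases hz : z = c <;> simp [hz]
    · by_cases hp : pet i = c
      · subst hp; simp [merge_pet_of_ne _ hij, hij]
      · simp [merge_pet_of_ne _ hij, hij, hp]
  rw [Finset.sum_congr rfl fun i _ => key i, Finset.sum_add_distrib]
  congr 1
  rw [Finset.sum_ite, Finset.sum_const_zero, add_zero]
  by_cases hz : z = c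
  · rw [if_pos hz]
    have hf : Finset.univ.filter (fun i : Fin m => i = j ∧ z = c) = {j} := by
      ext i; simp [hz]
    rw [hf, Finset.sum_singleton]
  · rw [if_neg hz]
    have hf : Finset.univ.filter (fun i : Fin m => i = j ∧ z = c) = ∅ := by
      ext i; simp [hz]
    rw [hf, Finset.sum_empty]

/-- **Core mass is unchanged** by a merge into a petal or the outside. [this work] -/
theorem pushWeight_merge_core (ν : Sun m → ℝ) (j : Fin m) {z : Sun m} (hz : z ≠ core) :
    pushWeight ν (merge j z) core = ν core := by
  rw [pushWeight_merge_apply, sum_merge_pet_ite]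
  simp [hz]

/-- **The merged petal becomes null.** [this work] -/
theorem pushWeight_merge_pet_self (ν : Sun m → ℝ) (j : Fin m) {z : Sun m} (hz : z ≠ pet j) :
    pushWeight ν (merge j z) (pet j) = 0 := by
  rw [pushWeight_merge_apply, sum_merge_pet_ite]
  simp only [reduceCtorEq, if_false, zero_add, hz]
  refine Finset.sum_eq_zero fun i _ => ?_
  by_cases hij : i = j
  · simp [hij]
  · simp [hij, pet_injective.ne hij]

/-- **Other petals keep their mass** (a petal that is neither merged nor the target). [this work] -/
theorem pushWeight_merge_pet_of_ne (ν : Sun m → ℝ) (j : Fin m) {z : Sun m} {i : Fin m} (hij : i ≠ j) (hz : z ≠ pet i) :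
    pushWeight ν (merge j z) (pet i) = ν (pet i) := by
  rw [pushWeight_merge_apply, sum_merge_pet_ite]
  simp only [reduceCtorEq, if_false, zero_add, hz]
  rw [Finset.sum_eq_single i]
  · simp [hij]
  · intro k _ hki
    simp [pet_injective.ne hki]
  · intro h; exact absurd (Finset.mem_univ i) h

/-- **Outside merge: the outside gains the petal's mass.** [this work] -/
theorem pushWeight_merge_out_out (ν : Sun m → ℝ) (j : Fin m) :
    pushWeight ν (merge j out) out = ν out + ν (pet j) := by
  rw [pushWeight_merge_apply, sum_merge_pet_ite]
  simp

/-- **Petal merge: the outside is unchanged.** [this work] -/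
theorem pushWeight_merge_pet_out (ν : Sun m → ℝ) (j x : Fin m) :
    pushWeight ν (merge j (pet x)) out = ν out := by
  rw [pushWeight_merge_apply, sum_merge_pet_ite]
  simp

/-- **Petal merge: the target petal gains the merged petal's mass.** [this work] -/
theorem pushWeight_merge_pet_target (ν : Sun m → ℝ) {j x : Fin m} (hxj : x ≠ j) :
    pushWeight ν (merge j (pet x)) (pet x) = ν (pet x) + ν (pet j) := by
  rw [pushWeight_merge_apply, sum_merge_pet_ite]
  simp only [reduceCtorEq, if_false, zero_add, if_true]
  rw [Finset.sum_eq_single x]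
  · simp [hxj]; ring
  · intro k _ hkx
    simp [pet_injective.ne hkx]
  · intro h; exact absurd (Finset.mem_univ x) h

/-- The petal masses of the outside-merged weight, all cases. [this work] -/
theorem pushWeight_merge_out_pet (ν : Sun m → ℝ) (j i : Fin m) :
    pushWeight ν (merge j out) (pet i) = if i = j then 0 else ν (pet i) := by
  by_cases hij : i = j
  · subst hij; rw [if_pos rfl]; exact pushWeight_merge_pet_self ν i (by simp)
  · rw [if_neg hij]; exact pushWeight_merge_pet_of_ne ν j hij (by simp)

/-- The petal masses of the petal-merged weight, all cases (`x ≠ j`). [this work] -/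
theorem pushWeight_merge_pet_pet (ν : Sun m → ℝ) {j x : Fin m} (hxj : x ≠ j) (i : Fin m) :
    pushWeight ν (merge j (pet x)) (pet i) = if i = j then 0 else if i = x then ν (pet x) + ν (pet j) else ν (pet i) := by
  by_cases hij : i = j
  · subst hij; rw [if_pos rfl]
    exact pushWeight_merge_pet_self ν i (by intro h; exact hxj (pet_injective h))
  · rw [if_neg hij]
    by_cases hix : i = x
    · subst hix; rw [if_pos rfl]; exact pushWeight_merge_pet_target ν hxj
    · rw [if_neg hix]
      exact pushWeight_merge_pet_of_ne ν j hij (by intro h; exact hix (pet_injective h).symm)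

/-- **As `update`s**: the petal-mass vector of the outside-merged weight is `c[j ↦ 0]`. [this work] -/
theorem petMass_merge_out (ν : Sun m → ℝ) (j : Fin m) :
    (fun i => pushWeight ν (merge j out) (pet i)) = update (fun i => ν (pet i)) j 0 := by
  funext i
  rw [pushWeight_merge_out_pet]
  by_cases hij : i = j
  · subst hij; simp
  · simp [hij]

/-- **As `update`s**: the petal-mass vector of the petal-merged weight is `c[x ↦ c_x + c_j][j ↦ 0]`. [this work] -/
theorem petMass_merge_pet (ν : Sun m → ℝ) {j x : Fin m} (hxj : x ≠ j) :
    (fun i => pushWeight ν (merge j (pet x)) (pet i)) =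
      update (update (fun i => ν (pet i)) x (ν (pet x) + ν (pet j))) j 0 := by
  funext i
  rw [pushWeight_merge_pet_pet ν hxj]
  by_cases hij : i = j
  · subst hij; simp
  · rw [if_neg hij, update_of_ne hij]
    by_cases hix : i = x
    · subst hix; simp
    · simp [hix]

end Sun
end Summit.CriticalPhenomena.PercolationContinuityZ3.Theorems.SahiDeltaSystem
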